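import Summits.Ventures.AbcSig.Rows.TemplateHalves
import Summits.Ventures.AbcSig.Levels.N2504

/-!
# Venture AbcSig — ROW `C2aL313A45yoddAB`: `313^m·xⁿ + 2^a·yⁿ = z²` (SECOND coefficient distribution of the cell; the distribution `xⁿ + 2^a·313^m·yⁿ = z²` is `Rows/C2aL313A45yodd.lean`), class `a 45yodd` (GENERATED by plean/leanrow.py)

HONEST FRAMING. A row of a COMPUTATION cell (`pub-abcsig`); a CONDITIONAL theorem, no claim on ABC or any summit.
Hypotheses: `BS04Package` (CITED), `DataComplete` at levels [2504] (COMPUTED, two-engine certified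
level files), and the listed per-orbit exclusions `hX_…` (CITED — e.g. the cell's M6 Eisenstein certificates; the
row's R5 cell names each). Everything else is kernel-checked (`Rows/TemplateAB.lean`, `Levels/N….lean` — the SAME level files as the first distribution). Exponent
range: prime `n ≥ 11`, `n ≠ 313`; `B = 2^a 313^m` with `a, m < n` (n-th-power free). PARITY HALF: only solutions with y ODD (y = the variable whose coefficient carries the power of 2) are claimed; the y-even half of this cell is unresolved (lead RULING F14).
Row of record:  (sha256 ; SIGNED 2026-08-22T10:05:22Z by referee (ref-g5)); its R0: THEOREM (sieve-complete) for all primes n >= 11 with n coprime to 5008 — class: candidate (a in {4,5} cell, y ODD only: the y-even sub-case lands at level 2l wh. Exponents left open by the row of record are excluded here via ; kernel-sieve residuals the row of record closes by a cell module (M6 Eisenstein / M4 Kraus certificates) appear as CITED hypotheses .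
-/

namespace Summit.Ventures.AbcSig

/-- Row `C2aL313A45yoddAB`: second coefficient distribution `313^m·xⁿ + 2^a·yⁿ = z²` (see module docstring). -/
theorem row_C2aL313A45yoddAB (M : NewformModel) (hP : M.BS04Package)
    (hD2504 : M.DataComplete 2504 level2504Orbits)
    (n : ℕ) (hn : n.Prime) (hmin : 11 ≤ n) (hnℓ : n ≠ 313) (a m : ℕ) (ha : a = 4 ∨ a = 5) (hm : 1 ≤ m) (han : a < n) (hmn : m < n)
    (hX_orbit_2504_4 : n ∈ ([7, 11] : List ℕ) → M.Excludes 2504 orbit_2504_4 (famAB (313 ^ m) (2 ^ a) n (fun _ _ => True)))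
    (x y z : ℤ) (hy : ¬ 2 ∣ y) (hxy1 : x * y ≠ 1) (hxy2 : x * y ≠ -1) : ¬ IsPrimitiveSolution (313 ^ m) (2 ^ a) 1 n x y z := by
  have hℓ : Nat.Prime 313 := by norm_num
  have h7 : 7 ≤ n := by omega
  have hS2504 :=
    (level2504_sieve n hn h7 (fun o => M.Excludes 2504 o (famAB (313 ^ m) (2 ^ a) n (fun _ _ => True))) (fun h => absurd h (by simp only [List.mem_cons, List.not_mem_nil, or_false]; omega)) (fun h => absurd h (by simp only [List.mem_cons, List.not_mem_nil, or_false]; omega)) hX_orbit_2504_4 (fun h => absurd h (by simp only [List.mem_cons, List.not_mem_nil, or_false]; omega)))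
  exact rowC2aAB_a45_yodd 313 hℓ (by norm_num) M hP n hn h7 hnℓ hD2504 a m ha hm han hmn
    hS2504 x y z hy hxy1 hxy2

end Summit.Ventures.AbcSig
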